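import Mathlib
import HarnessLib

/-!
# Gaussian sums (helper for stub `stub_treeRatioFloor`, crux stmt-QuantumFields-9365)

Elementary estimates for the truncated Gaussian sums that control the cycle heat kernel:
* `∑_{j=1}^{N} e^{-α j²} ≤ √(π/α)/2` (comparison with the Gaussian integral, `α > 0`),
* `∑_{j=0}^{N} e^{-α j²} ≤ 1 + √(π/α)/2`,
* `∑_{j=0}^{N} j² e^{-α j²} ≤ √(2π/α)/α` (via `x e^{-x/2} ≤ 2`),
* the counting bound `m³/3 ≤ ∑_{j=1}^{m} j²` and floor facts used for the matching lower bounds,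
* the algebraic identity `√(16 s/L²) = 4√s/L`.
Theorems only, Mathlib only; the first bound is the registered helper stub `GaussianSumBound`.
-/

noncomputable section

namespace Summit.QuantumFields.YangMills.Theorems.FemtoCurvatureSkewness

open Finset MeasureTheory
open scoped BigOperators

namespace CycleKernel

/-- **Gaussian sum vs. Gaussian integral.** `∑_{i<N} e^{-α (i+1)²} ≤ ∫₀^∞ e^{-α x²} dx = √(π/α)/2`. -/
theorem sum_exp_neg_mul_sq_le {α : ℝ} (hα : 0 < α) (N : ℕ) :
    ∑ i ∈ range N, Real.exp (-(α * ((i : ℝ) + 1) ^ 2)) ≤ Real.sqrt (Real.pi / α) / 2 := by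
  set f : ℝ → ℝ := fun x => Real.exp (-α * x ^ 2) with hf
  have hanti : AntitoneOn f (Set.Icc (0 : ℝ) (0 + N)) := by
    intro x hx y _ hxy
    simp only [hf]
    rw [Real.exp_le_exp]
    have hx0 : 0 ≤ x := hx.1
    nlinarith [mul_le_mul_of_nonneg_left (mul_self_le_mul_self hx0 hxy) hα.le]
  have h1 := AntitoneOn.sum_le_integral hanti
  have h2 : ∫ x in (0 : ℝ)..0 + N, f x ≤ Real.sqrt (Real.pi / α) / 2 := by
    rw [intervalIntegral.integral_of_le (by positivity), ← integral_gaussian_Ioi α]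
    exact setIntegral_mono_set (integrable_exp_neg_mul_sq hα).integrableOn
      (ae_of_all _ fun x => Real.exp_nonneg _) Set.Ioc_subset_Ioi_self.eventuallyLE
  calc ∑ i ∈ range N, Real.exp (-(α * ((i : ℝ) + 1) ^ 2))
      = ∑ i ∈ range N, f (0 + ((i + 1 : ℕ) : ℝ)) := by
        refine Finset.sum_congr rfl fun i _ => ?_
        simp only [hf]
        push_cast
        ring_nf
    _ ≤ _ := h1.trans h2

/-- `∑_{j=0}^{N} e^{-α j²} ≤ 1 + √(π/α)/2`. -/
theorem sum_range_succ_exp_le {α : ℝ} (hα : 0 < α) (N : ℕ) :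
    ∑ j ∈ range (N + 1), Real.exp (-(α * (j : ℝ) ^ 2)) ≤ 1 + Real.sqrt (Real.pi / α) / 2 := by
  rw [Finset.sum_range_succ']
  simp only [Nat.cast_add, Nat.cast_one, CharP.cast_eq_zero]
  rw [add_comm]
  gcongr
  · simp
  · exact sum_exp_neg_mul_sq_le hα N

/-- `x e^{-x} ≤ 2 e^{-x/2}`-type bound: `x · e^{-x} ≤ 2 e^{-x/2}`, from `1 + x/2 ≤ e^{x/2}`. -/
theorem mul_exp_neg_le (x : ℝ) : x * Real.exp (-x) ≤ 2 * Real.exp (-(x / 2)) := by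
  have h1 : x / 2 + 1 ≤ Real.exp (x / 2) := Real.add_one_le_exp _
  have h2 : Real.exp (-x) = Real.exp (-(x / 2)) * Real.exp (-(x / 2)) := by
    rw [← Real.exp_add]; ring_nf
  have h3 : x * Real.exp (-(x / 2)) ≤ 2 := by
    have h4 : Real.exp (-(x / 2)) * Real.exp (x / 2) = 1 := by rw [← Real.exp_add]; simp
    have h5 : 0 ≤ Real.exp (-(x / 2)) := Real.exp_nonneg _
    nlinarith [mul_le_mul_of_nonneg_left h1 h5]
  rw [h2, ← mul_assoc]
  have h5 : 0 ≤ Real.exp (-(x / 2)) := Real.exp_nonneg _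
  nlinarith

/-- `∑_{j=0}^{N} j² e^{-α j²} ≤ √(2π/α)/α`. -/
theorem sum_range_succ_sq_mul_exp_le {α : ℝ} (hα : 0 < α) (N : ℕ) :
    ∑ j ∈ range (N + 1), (j : ℝ) ^ 2 * Real.exp (-(α * (j : ℝ) ^ 2)) ≤ Real.sqrt (2 * Real.pi / α) / α := by
  rw [Finset.sum_range_succ']
  simp only [Nat.cast_add, Nat.cast_one, CharP.cast_eq_zero]
  have hα2 : 0 < α / 2 := by positivity
  have key : ∀ i ∈ range N, ((i : ℝ) + 1) ^ 2 * Real.exp (-(α * ((i : ℝ) + 1) ^ 2)) ≤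
      2 / α * Real.exp (-(α / 2 * ((i : ℝ) + 1) ^ 2)) := by
    intro i _
    have h := mul_exp_neg_le (α * ((i : ℝ) + 1) ^ 2)
    have e : α * ((i : ℝ) + 1) ^ 2 / 2 = α / 2 * ((i : ℝ) + 1) ^ 2 := by ring
    rw [e] at h
    calc ((i : ℝ) + 1) ^ 2 * Real.exp (-(α * ((i : ℝ) + 1) ^ 2))
        = 1 / α * (α * ((i : ℝ) + 1) ^ 2 * Real.exp (-(α * ((i : ℝ) + 1) ^ 2))) := by
          field_simp
      _ ≤ 1 / α * (2 * Real.exp (-(α / 2 * ((i : ℝ) + 1) ^ 2))) := by gcongr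
      _ = 2 / α * Real.exp (-(α / 2 * ((i : ℝ) + 1) ^ 2)) := by ring
  calc ∑ i ∈ range N, ((i : ℝ) + 1) ^ 2 * Real.exp (-(α * ((i : ℝ) + 1) ^ 2)) +
        (0 : ℝ) ^ 2 * Real.exp (-(α * (0 : ℝ) ^ 2))
      = ∑ i ∈ range N, ((i : ℝ) + 1) ^ 2 * Real.exp (-(α * ((i : ℝ) + 1) ^ 2)) := by ring
    _ ≤ ∑ i ∈ range N, 2 / α * Real.exp (-(α / 2 * ((i : ℝ) + 1) ^ 2)) := Finset.sum_le_sum key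
    _ = 2 / α * ∑ i ∈ range N, Real.exp (-(α / 2 * ((i : ℝ) + 1) ^ 2)) := by rw [Finset.mul_sum]
    _ ≤ 2 / α * (Real.sqrt (Real.pi / (α / 2)) / 2) := by gcongr; exact sum_exp_neg_mul_sq_le hα2 N
    _ = Real.sqrt (2 * Real.pi / α) / α := by
        have e : Real.pi / (α / 2) = 2 * Real.pi / α := by field_simp
        rw [e]
        ring

/-- Counting lower bound `m³/3 ≤ ∑_{i<m} (i+1)²`. -/
theorem cube_div_three_le_sum_sq (m : ℕ) : (m : ℝ) ^ 3 / 3 ≤ ∑ i ∈ range m, ((i : ℝ) + 1) ^ 2 := by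
  induction m with
  | zero => simp
  | succ m ih =>
    rw [Finset.sum_range_succ]
    push_cast
    have hm : (0 : ℝ) ≤ m := Nat.cast_nonneg m
    nlinarith [ih, hm]

/-- Floor facts for `x ≥ 1`: `m = ⌊x⌋₊` satisfies `1 ≤ m`, `x/2 ≤ m ≤ x < m + 1`. -/
theorem floor_facts {x : ℝ} (hx : 1 ≤ x) :
    1 ≤ ⌊x⌋₊ ∧ x / 2 ≤ (⌊x⌋₊ : ℝ) ∧ (⌊x⌋₊ : ℝ) ≤ x ∧ x < (⌊x⌋₊ : ℝ) + 1 := by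
  have h1 : 1 ≤ ⌊x⌋₊ := Nat.le_floor (by exact_mod_cast hx)
  have h3 : (⌊x⌋₊ : ℝ) ≤ x := Nat.floor_le (by linarith)
  have h4 : x < (⌊x⌋₊ : ℝ) + 1 := Nat.lt_floor_add_one x
  have h1' : (1 : ℝ) ≤ ⌊x⌋₊ := by exact_mod_cast h1
  exact ⟨h1, by linarith, h3, h4⟩

/-- `√(16 s/L²) = 4 √s / L` for `L > 0`. -/
theorem sqrt_sixteen_mul_div_sq {s L : ℝ} (hs : 0 ≤ s) (hL : 0 < L) :
    Real.sqrt (16 * s / L ^ 2) = 4 * Real.sqrt s / L := by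
  have e : 16 * s / L ^ 2 = (4 * Real.sqrt s / L) ^ 2 := by
    rw [div_pow, mul_pow, Real.sq_sqrt hs]
    norm_num
  rw [e, Real.sqrt_sq (by positivity)]

/-- `√(π/α) = L √π/(4 √s)` and friends are used through this form: `√(c/α) = √c / √α`. -/
theorem sqrt_div_eq {c α : ℝ} (hc : 0 ≤ c) : Real.sqrt (c / α) = Real.sqrt c / Real.sqrt α :=
  Real.sqrt_div hc α

end CycleKernel

/-- **Gaussian sum bound** (registered helper stub `GaussianSumBound` of stmt-QuantumFields-9365). -/
theorem GaussianSumBound : ∀ (α : ℝ), 0 < α → ∀ (N : ℕ),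
    ∑ i ∈ Finset.range N, Real.exp (-(α * ((i : ℝ) + 1) ^ 2)) ≤ Real.sqrt (Real.pi / α) / 2 :=
  fun _ hα N => CycleKernel.sum_exp_neg_mul_sq_le hα N

end Summit.QuantumFields.YangMills.Theorems.FemtoCurvatureSkewness

end
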